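import Summits.CriticalPhenomena.PercolationContinuityZ3.Theses.PercExchangeRateTransport

/-!
# Stub 1 `curveRatioLimit` of the crux K⁻ (`SubcritExchangeUniformity`, stmt-CriticalPhenomena-16062),
# line `Sketch`/`onesided` — conditional derivation from the route items K⁺ ∧ `CriticalCurveRegular`

The on-curve slice of the exchange-rate limit (the registered stub `stub_curveRatioLimit`: for every
compact sub-arc `[lo,hi] ⊂ (0,1)` there is `σ` continuous on `[lo,hi]` with
`|∂_tΘ_n(p_c t,t) − σ(t) ∂_pΘ_n(p_c t,t)| ≤ η ∂_pΘ_n(p_c t,t)` for `n ≥ m(η)`) is, from scratch, an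
open problem (critical-window ratio limit of two pivotal intensities on `ℤ²×ℤ`, no RSW). It is
however a BY-NAME CONSEQUENCE of two route items:

* K⁺ = `PercExchangeRateTransport.SupercritExchangeUniformity` (stmt-CriticalPhenomena-16061), stated on
  the CLOSED supercritical collar `{t ∈ [lo,hi], p_c(t) ≤ p ≤ p_c(t)+ρ}`, curve included;
* `PercExchangeRateTransport.CriticalCurveRegular` (stmt-CriticalPhenomena-16065): `p_c` continuous on
  `(0,1)`.

Take `σ t := a (p_c t) t`; continuity on `[lo,hi]` is `ContinuousOn.comp` of the collar-continuous
field with the continuous curve `t ↦ (p_c t, t)`, and the inequality is K⁺'s specialised to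
`p = p_c t`. This file proves exactly that implication, `curveRatioLimit_of_items`, whose conclusion
is the registered let-form statement of `stub_curveRatioLimit` verbatim (no definitions: the `let`
preambles of the route items and of the stub are syntactically identical, so they unfold to
definitionally equal objects).
-/

noncomputable section

namespace Summit.CriticalPhenomena.PercolationContinuityZ3.Theorems.SubcritExchangeUniformity

open MeasureTheory
open Literature.Probability.Percolation Literature.Probability.LatticeModels

/-- **Stub 1 (`stub_curveRatioLimit`) from the route items K⁺ and `CriticalCurveRegular`.**
If the finite-volume exchange rate converges uniformly on the closed supercritical collar to a
field `a` continuous there (K⁺ = `SupercritExchangeUniformity`), and the critical curve `p_c` is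
continuous on `(0,1)` (`CriticalCurveRegular`), then on every compact sub-arc `[lo,hi] ⊂ (0,1)` the
on-curve exchange rate converges uniformly to the continuous `σ t := a (p_c t) t`:
`|∂_tΘ_n(p_c t,t) − σ(t) ∂_pΘ_n(p_c t,t)| ≤ η ∂_pΘ_n(p_c t,t)` for `n ≥ m(η)`, `t ∈ [lo,hi]`.
The conclusion is the registered statement of `stub_curveRatioLimit` verbatim.
[GarbanPeteSchramm2013Pivotal; AizenmanGrimmett1991; doi:10.1103/PhysRevB.27.4394] -/
theorem curveRatioLimit_of_items : Summit.CriticalPhenomena.PercolationContinuityZ3.Theses.PercExchangeRateTransport.SupercritExchangeUniformity → Summit.CriticalPhenomena.PercolationContinuityZ3.Theses.PercExchangeRateTransport.CriticalCurveRegular → let μ := labelMeasure (Site 3); let vert : Sym2 (Site 3) → Prop := fun e => ∃ x : Site 3, e = s(x, x + Pi.single (2 : Fin 3) 1); let cfg : ℝ → ℝ → (Sym2 (Site 3) → ℝ) → Set (Sym2 (Site 3)) := fun p t U => {e | e ∈ (zdGraph 3).edgeSet ∧ ((vert e ∧ U e ≤ t) ∨ (¬ vert e ∧ U e ≤ p))};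 let Θ : ℕ → ℝ → ℝ → ℝ := fun n p t => μ.real {U | cfg p t U ∈ siteToBoundary 3 n}; let θ : ℝ → ℝ → ℝ := fun p t => μ.real {U | cfg p t U ∈ percolatesAt (0 : Site 3)}; let pc : ℝ → ℝ := fun t => sInf ({p : ℝ | 0 ≤ p ∧ p ≤ 1 ∧ 0 < θ p t} ∪ {1}); ∀ lo hi : ℝ, 0 < lo → lo < hi → hi < 1 → ∃ σ : ℝ → ℝ, ContinuousOn σ (Set.Icc lo hi) ∧ ∀ η > (0 : ℝ), ∃ m : ℕ, ∀ n ≥ m, ∀ t ∈ Set.Icc lo hi, |deriv (fun s => Θ n (pc t) s) t - σ t * deriv (fun q => Θ n q t) (pc t)| ≤ η * deriv (fun q => Θ n q t) (pc t) := by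
  intro hSup hCC μ vert cfg Θ θ pc lo hi hlo hlh hhi
  -- K⁺ on `[lo,hi]`: collar width `ρ`, field `a` continuous on the closed collar, rate bound.
  obtain ⟨ρ, hρ, L, a, hcont, -, hrate⟩ := hSup lo hi hlo hlh hhi
  -- `CriticalCurveRegular`: `p_c` is continuous on `(0,1) ⊇ [lo,hi]`.
  obtain ⟨hpc, -⟩ := hCC
  have hsub : Set.Icc lo hi ⊆ Set.Ioo (0 : ℝ) 1 := fun t ht =>
    ⟨hlo.trans_le ht.1, ht.2.trans_lt hhi⟩
  -- the curve `t ↦ (p_c t, t)` is continuous on `[lo,hi]` and lands in the closed collar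
  have hγ : ContinuousOn (fun t : ℝ => ((pc t, t) : ℝ × ℝ)) (Set.Icc lo hi) :=
    (hpc.mono hsub).prodMk continuousOn_id
  have hmaps : Set.MapsTo (fun t : ℝ => ((pc t, t) : ℝ × ℝ)) (Set.Icc lo hi)
      {x : ℝ × ℝ | x.2 ∈ Set.Icc lo hi ∧ pc x.2 ≤ x.1 ∧ x.1 ≤ pc x.2 + ρ} := fun t ht =>
    ⟨ht, le_rfl, le_add_of_nonneg_right hρ.le⟩
  refine ⟨fun t => a (pc t) t, hcont.comp hγ hmaps, fun η hη => ?_⟩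
  obtain ⟨m, hm⟩ := hrate η hη
  exact ⟨m, fun n hn t ht => hm n hn t ht (pc t) le_rfl (le_add_of_nonneg_right hρ.le)⟩

end Summit.CriticalPhenomena.PercolationContinuityZ3.Theorems.SubcritExchangeUniformity

end
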